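import Literature.NumberTheory.Sieve.GoldbachLinnikRomanovCertDefs
import Literature.NumberTheory.Sieve.GoldbachLinnikRomanovCertData1
import Literature.NumberTheory.Sieve.GoldbachLinnikRomanovCertData2
import Literature.NumberTheory.LFunctions.ChainTable

/-!
# Romanov certificate — cofactor check 3/5

Kernel evaluation (`decide +kernel`) of the checker of `GoldbachLinnikRomanovCertDefs.lean` on the records
`parseRecs 20000 (digitsOf (fsegs1 ++ fsegs2))` of `GoldbachLinnikRomanovCertData1/2.lean`; soundness: `GoldbachLinnikRomanovCertSound1.lean`,
`GoldbachLinnikRomanovCertTop.lean`. [folklore]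
-/

namespace Literature.NumberTheory.Sieve.RomanovCert

set_option maxHeartbeats 0 in
/-- The cofactors `c_e`, `e ∈ [16384, 20480)`, are coprime to the product of the prime table. [folklore] -/
theorem cof5 : cofCheck LFunctions.ChainTable.table (parseRecs 20000 (digitsOf (fsegs1 ++ fsegs2))) 8000000 16384 4096 = true := by
  decide +kernel

set_option maxHeartbeats 0 in
/-- The cofactors `c_e`, `e ∈ [20480, 23170)`, are coprime to the product of the prime table. [folklore] -/
theorem cof6 : cofCheck LFunctions.ChainTable.table (parseRecs 20000 (digitsOf (fsegs1 ++ fsegs2))) 8000000 20480 2690 = true := by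
  decide +kernel

end Literature.NumberTheory.Sieve.RomanovCert
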